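import Mathlib
import Summits.NavierStokesRegularity.OSWSelfSimilar.SheetHalfLineIdentity
import Summits.NavierStokesRegularity.OSWSelfSimilar.SheetHalfLineHilbertSign
import HarnessLib

/-!
# Viscous gCLM/OSW profile MODEL: the ORIGIN-STRETCHING FLOOR `HΩ(0) ≥ 2(c_ω − c_l)/(1 + a)` of an E-signed sheet profile
# (the quantitative form of the sign laws of `SheetHalfLineIdentity` / `SheetHalfLineSignLaws`)

HONEST FRAMING (cell ns-blowup GROUP B «PROFILE SEARCH», zone Z3 = the 1-D viscous gCLM/OSW sheet; human rulings
D-0035/D-0074): **1-D MODEL; not Euler, not Navier–Stokes; «violates: none — MODEL».** Nothing here is a statement about NS.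

OBJECT. The frozen-`ε` sheet map `G = c_ω Ω + c_l ξΩ′ + a𝒰Ω′ − (HΩ)Ω − εΩ″` (`HouLuoOriginLaws.F1 … 1 … 0`) with the GENUINE
Hilbert transform `H = hilbertTransform` and `𝒰′ = HΩ`, for an E-SIGNED profile (`Ω ≤ 0` on `(0,∞)`, the sign class of E½).
The half-line identity (★) reads `(c_ω − c_l)‖Ω‖_{L¹(0,∞)} + ε|Ω′(0)| = (1+a)·π⁻¹ J`, `J = ∫₀^∞|Ω(x)|∫₀^∞|Ω(y)|/(x+y) dy dx`
(`SheetHalfLine.integral_Ioi_hilbertTransform_mul_eq`), and for an E-signed ODD profile the inner Carleman factor is bounded by the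
ORIGIN STRETCHING: `∫₀^∞ |Ω(y)|/(x+y) dy ≤ ∫₀^∞ |Ω(y)|/y dy = (π/2)·HΩ(0)` (`HΩ(0) = −(2/π)∫₀^∞ Ω(t)/t dt` straight from the
definition of `hilbertTransform` and oddness). Hence:

* `hilbertTransform_zero_eq` — `HΩ(0) = (2/π) ∫₀^∞ |Ω(t)|/t dt` for odd E-signed Lipschitz `Ω ∈ L¹`;
* `carleman_le_origin_stretching` — `J ≤ (π/2)·HΩ(0)·‖Ω‖_{L¹(0,∞)}`;
* `origin_stretching_floor` — **for `a ≥ −1` (any `c_l`, `ε`):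
  `(c_ω − c_l)·‖Ω‖_{L¹(0,∞)} + ε·|Ω′(0)| ≤ ½(1 + a)·HΩ(0)·‖Ω‖_{L¹(0,∞)}`**, and therefore, for `Ω ≢ 0`,
  `origin_stretching_lower_bound` — **`2(c_ω − c_l) ≤ (1 + a)·HΩ(0)`**: on the NS-type line (time gauge `c_ω = 1`, `c_l = ½`)
  every E-signed profile has `HΩ(0) ≥ 1/(1+a)` — at `a ≤ −1` this is the emptiness of `SheetHalfLineSignLaws`, and as
  `a ↓ −1` the origin stretching of any E-signed profile must DIVERGE (with the tree's origin law
  `SheetROriginLaw.origin_law_viscousGCLM`, `(1−a)HΩ(0) = 3/2 − εΩ‴(0)/Ω′(0)`, this forces `−εΩ‴(0)/Ω′(0) ≥ (1−a)/(1+a) − 3/2 → ∞`: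
  extreme concentration at the origin). Checks (not kernel): E½ at `a = 0.2` has `HΩ(0) = 3.9487 ≥ 1/1.2 = 0.83` ✓; the Schochet
  corner (`c_ω → 0⁺` in the amplitude gauge) has floor `→ 0` ✓ (`HΩ_S(0) = 1.44`); CENSUS-Z3 row Z3-E12⁻: any E-signed candidate the
  «NONE FOUND» search at `a ∈ {−0.9, …, −0.1}` could have missed must carry origin stretching `≥ 1/(1+a) = 10, 4, 2, 1.33, 1.11`
  (time gauge) — a quantitative rider for the census.
NOT PROVED: anything for sign-changing profiles; existence; anything about NS. bears_on: LADDER-NS N5 / Z3 clause (i′) → N1.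
-/

noncomputable section
open Set Filter Topology MeasureTheory
open scoped Real

namespace Summit.NavierStokesRegularity.OSWSelfSimilar
namespace SheetHalfLine
open HouLuoOriginLaws (F1)
open Literature.Analysis.Fourier

/-- For a `K`-Lipschitz `Ω ∈ L¹` with `Ω(0) = 0`, `t ↦ Ω(t)/t` is integrable on `(0,∞)` (bounded by `K e^{1−t} + |Ω t|`).
[folklore] -/
theorem integrableOn_div_id {Om : ℝ → ℝ} {K : ℝ} (hK : 0 ≤ K) (hLip : ∀ u v, |Om u - Om v| ≤ K * |u - v|)
    (h0 : Om 0 = 0) (hΩi : Integrable Om) : IntegrableOn (fun t => Om t / t) (Ioi 0) := by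
  have hΩc : Continuous Om :=
    (LipschitzWith.of_dist_le_mul (K := Real.toNNReal K) (f := Om) fun u v => by
      rw [Real.dist_eq, Real.dist_eq, Real.coe_toNNReal _ hK]; exact hLip u v).continuous
  have hk : IntegrableOn (fun y => K * (Real.exp 1 * Real.exp (-y)) + |Om y|) (Ioi (0:ℝ)) :=
    (((integrableOn_exp_neg_Ioi 0).const_mul (Real.exp 1)).const_mul K).add hΩi.abs.integrableOn
  refine Integrable.mono' hk ((hΩc.measurable.div measurable_id).aestronglyMeasurable) ?_
  rw [ae_restrict_iff' measurableSet_Ioi]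
  refine ae_of_all _ fun y hy => ?_
  have hy0 : 0 < y := hy
  have hKy : |Om y| ≤ K * y := by
    have h := hLip y 0
    rw [h0, sub_zero, sub_zero, abs_of_pos hy0] at h
    exact h
  rw [Real.norm_eq_abs, abs_div, abs_of_pos hy0]
  have hpos : 0 ≤ K * (Real.exp 1 * Real.exp (-y)) := by positivity
  rcases le_or_gt y 1 with hy1 | hy1
  · have h1 : |Om y| / y ≤ K := by rw [div_le_iff₀ hy0]; exact hKy
    have h2 : (1:ℝ) ≤ Real.exp 1 * Real.exp (-y) := by
      rw [← Real.exp_add]; exact Real.one_le_exp (by linarith)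
    have h3 : K ≤ K * (Real.exp 1 * Real.exp (-y)) := le_mul_of_one_le_right hK h2
    linarith [abs_nonneg (Om y)]
  · have h1 : |Om y| / y ≤ |Om y| := div_le_self (abs_nonneg _) hy1.le
    linarith

/-- **The origin stretching as a half-line integral.** For an odd profile, straight from the definition of the Hilbert transform,
`HΩ(0) = π⁻¹ ∫₀^∞ (Ω(−t) − Ω(t))/t dt = −(2/π) ∫₀^∞ Ω(t)/t dt`. [folklore] -/
theorem hilbertTransform_zero_eq {Om : ℝ → ℝ} (hodd : ∀ y, Om (-y) = -Om y) :
    hilbertTransform Om 0 = -(2 / π) * ∫ t in Ioi (0:ℝ), Om t / t := by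
  unfold hilbertTransform
  have e : ∫ t in Ioi (0:ℝ), (Om (0 - t) - Om (0 + t)) / t = ∫ t in Ioi (0:ℝ), (-2) * (Om t / t) := by
    refine setIntegral_congr_fun measurableSet_Ioi fun t _ => ?_
    rw [zero_sub, zero_add, hodd]
    ring
  rw [e, integral_const_mul]
  ring

/-- **Carleman form ≤ origin stretching × mass** for an E-signed odd profile: with `Ω ≤ 0` on `(0,∞)`,
`∫₀^∞ Ω(x)∫₀^∞ Ω(y)/(x+y) dy dx ≤ (∫₀^∞ |Ω(t)|/t dt)·(∫₀^∞ |Ω(x)| dx)` (`1/(x+y) ≤ 1/y` for `x > 0`). [folklore] -/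
theorem carleman_le_origin_stretching {Om : ℝ → ℝ} {K : ℝ} (hK : 0 ≤ K) (hLip : ∀ u v, |Om u - Om v| ≤ K * |u - v|)
    (h0 : Om 0 = 0) (hΩi : Integrable Om) :
    ∫ x in Ioi (0:ℝ), Om x * ∫ y in Ioi (0:ℝ), Om y / (x + y)
      ≤ (∫ t in Ioi (0:ℝ), |Om t| / t) * ∫ x in Ioi (0:ℝ), |Om x| := by
  set M : ℝ := ∫ t in Ioi (0:ℝ), |Om t| / t with hM
  have hdiv := integrableOn_div_id hK hLip h0 hΩi
  have hdivabs : IntegrableOn (fun t => |Om t| / t) (Ioi (0:ℝ)) := by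
    refine IntegrableOn.congr_fun hdiv.norm (fun t ht => ?_) measurableSet_Ioi
    have ht0 : 0 < t := ht
    change ‖Om t / t‖ = |Om t| / t
    rw [Real.norm_eq_abs, abs_div, abs_of_pos ht0]
  -- inner bound: |∫ Ω y/(x+y)| ≤ M for x > 0
  have hinner : ∀ x, 0 < x → |∫ y in Ioi (0:ℝ), Om y / (x + y)| ≤ M := by
    intro x hx
    rw [← Real.norm_eq_abs]
    refine norm_integral_le_of_norm_le hdivabs ?_
    rw [ae_restrict_iff' measurableSet_Ioi]
    refine ae_of_all _ fun y hy => ?_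
    have hy0 : 0 < y := hy
    rw [Real.norm_eq_abs, abs_div, abs_of_pos (by linarith : 0 < x + y)]
    exact div_le_div_of_nonneg_left (abs_nonneg _) hy0 (by linarith)
  -- outer: |∫ Ω x K x| ≤ ∫ |Ω x| M
  have hprod : IntegrableOn (fun x => M * |Om x|) (Ioi (0:ℝ)) := (hΩi.abs.integrableOn).const_mul M
  have hle : |∫ x in Ioi (0:ℝ), Om x * ∫ y in Ioi (0:ℝ), Om y / (x + y)| ≤ ∫ x in Ioi (0:ℝ), M * |Om x| := by
    rw [← Real.norm_eq_abs]
    refine norm_integral_le_of_norm_le hprod ?_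
    rw [ae_restrict_iff' measurableSet_Ioi]
    refine ae_of_all _ fun x hx => ?_
    rw [norm_mul, Real.norm_eq_abs, Real.norm_eq_abs, mul_comm]
    exact mul_le_mul_of_nonneg_right (hinner x hx) (abs_nonneg _)
  rw [integral_const_mul] at hle
  exact (le_abs_self _).trans hle

/-- **THE ORIGIN-STRETCHING FLOOR (integrated form).** For an odd, `K`-Lipschitz, `L¹ ∩ L²`, `C²`, E-SIGNED (`Ω ≤ 0` on `(0,∞)`)
solution of the gCLM/OSW sheet equation with the genuine Hilbert transform on `(0,∞)`, in the decay class of (★), with `a ≥ −1`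
(any `c_l`, any `ε`):
`(c_ω − c_l)·‖Ω‖_{L¹(0,∞)} + ε·|Ω′(0)| ≤ ½(1 + a)·HΩ(0)·‖Ω‖_{L¹(0,∞)}`
(here `‖Ω‖_{L¹(0,∞)} = −∫₀^∞Ω`, `|Ω′(0)| = −Ω′(0)`, `HΩ(0) = (2/π)∫₀^∞|Ω|/t ≥ 0`). [new here — MODEL] -/
theorem origin_stretching_floor (cω cl a ε K : ℝ) (U Om dOm ddOm : ℝ → ℝ) (ha : -1 ≤ a) (hodd : ∀ y, Om (-y) = -Om y)
    (hK : 0 ≤ K) (hLip : ∀ u v, |Om u - Om v| ≤ K * |u - v|)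
    (hΩi : Integrable Om) (hΩ2 : MemLp Om 2)
    (hU : ∀ ξ, HasDerivAt U (hilbertTransform Om ξ) ξ) (hOm : ∀ ξ, HasDerivAt Om (dOm ξ) ξ)
    (hdOm : ∀ ξ, HasDerivAt dOm (ddOm ξ) ξ)
    (hF : ∀ ξ ∈ Ioi (0:ℝ), F1 cω cl a 1 ε (hilbertTransform Om) U Om dOm ddOm (fun _ => 0) ξ = 0)
    (iHOm : IntegrableOn (fun ξ => hilbertTransform Om ξ * Om ξ) (Ioi 0))
    (iξd : IntegrableOn (fun ξ => ξ * dOm ξ) (Ioi 0)) (iUd : IntegrableOn (fun ξ => U ξ * dOm ξ) (Ioi 0))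
    (idd : IntegrableOn ddOm (Ioi 0))
    (hξOm : Tendsto (fun ξ => ξ * Om ξ) atTop (𝓝 0)) (hUOm : Tendsto (fun ξ => U ξ * Om ξ) atTop (𝓝 0))
    (hdOmInf : Tendsto dOm atTop (𝓝 0)) (hsign : ∀ ξ ∈ Ioi (0:ℝ), Om ξ ≤ 0) :
    (cω - cl) * (-∫ ξ in Ioi (0:ℝ), Om ξ) + ε * (-dOm 0)
      ≤ (1 / 2) * (1 + a) * hilbertTransform Om 0 * (-∫ ξ in Ioi (0:ℝ), Om ξ) := by
  have hOm0 : Om 0 = 0 := by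
    have h := hodd 0
    rw [neg_zero] at h
    linarith
  -- (★) and the Carleman form
  have hid := halfLine_identity_gCLM cω cl a ε (hilbertTransform Om) U Om dOm ddOm hU hOm hdOm hOm0 hF hΩi.integrableOn iHOm iξd
    iUd idd hξOm hUOm hdOmInf
  have hcar := integral_Ioi_hilbertTransform_mul_eq hodd hK hLip hΩi hΩ2
  have hJ := carleman_le_origin_stretching hK hLip hOm0 hΩi
  -- |Ω| = −Ω and Ω/t ≤ 0 on (0,∞)
  have habs : ∫ x in Ioi (0:ℝ), |Om x| = -∫ x in Ioi (0:ℝ), Om x := by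
    rw [← integral_neg]
    exact setIntegral_congr_fun measurableSet_Ioi fun x hx => abs_of_nonpos (hsign x hx)
  have hdivabs : ∫ t in Ioi (0:ℝ), |Om t| / t = -∫ t in Ioi (0:ℝ), Om t / t := by
    rw [← integral_neg]
    refine setIntegral_congr_fun measurableSet_Ioi fun t ht => ?_
    have ht0 : 0 < t := ht
    rw [abs_of_nonpos (hsign t ht), neg_div]
  have hH0 : hilbertTransform Om 0 = (2 / π) * ∫ t in Ioi (0:ℝ), |Om t| / t := by
    rw [hilbertTransform_zero_eq hodd, hdivabs]
    ring
  have hMnonneg : 0 ≤ ∫ t in Ioi (0:ℝ), |Om t| / t :=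
    setIntegral_nonneg measurableSet_Ioi fun t ht => div_nonneg (abs_nonneg _) (le_of_lt ht)
  have hI1 : 0 ≤ -∫ ξ in Ioi (0:ℝ), Om ξ := by
    rw [← habs]; exact setIntegral_nonneg measurableSet_Ioi fun x _ => abs_nonneg _
  -- J ≤ M · ‖Ω‖₁ = (π/2) HΩ(0) · ‖Ω‖₁
  have hJ' : ∫ x in Ioi (0:ℝ), Om x * ∫ y in Ioi (0:ℝ), Om y / (x + y)
      ≤ (π / 2 * hilbertTransform Om 0) * (-∫ ξ in Ioi (0:ℝ), Om ξ) := by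
    have e : π / 2 * hilbertTransform Om 0 = ∫ t in Ioi (0:ℝ), |Om t| / t := by
      rw [hH0]; field_simp
    rw [e, ← habs]
    exact hJ
  -- assemble: (cω−cl)(−∫Ω) + ε(−Ω′(0)) = (1+a)·π⁻¹·J ≤ (1+a)·π⁻¹·(π/2)HΩ(0)(−∫Ω)
  have hkey : (cω - cl) * (-∫ ξ in Ioi (0:ℝ), Om ξ) + ε * (-dOm 0)
      = (1 + a) * (π⁻¹ * ∫ x in Ioi (0:ℝ), Om x * ∫ y in Ioi (0:ℝ), Om y / (x + y)) := by
    rw [hcar] at hid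
    linear_combination -hid
  rw [hkey]
  have h1a : 0 ≤ 1 + a := by linarith
  have hπ : 0 < π := Real.pi_pos
  calc (1 + a) * (π⁻¹ * ∫ x in Ioi (0:ℝ), Om x * ∫ y in Ioi (0:ℝ), Om y / (x + y))
      ≤ (1 + a) * (π⁻¹ * ((π / 2 * hilbertTransform Om 0) * (-∫ ξ in Ioi (0:ℝ), Om ξ))) :=
        mul_le_mul_of_nonneg_left (mul_le_mul_of_nonneg_left hJ' (by positivity)) h1a
    _ = (1 / 2) * (1 + a) * hilbertTransform Om 0 * (-∫ ξ in Ioi (0:ℝ), Om ξ) := by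
        field_simp

/-- **THE ORIGIN-STRETCHING LOWER BOUND `2(c_ω − c_l) ≤ (1 + a)·HΩ(0)`** for every NONTRIVIAL E-signed profile as in
`origin_stretching_floor` (divide by `‖Ω‖_{L¹(0,∞)} > 0`, drop `ε|Ω′(0)| ≥ 0`). Time gauge on the NS-type line (`c_ω = 1`,
`c_l = ½`): `HΩ(0) ≥ 1/(1+a)`; at `a = −1` no such profile (the sign law), and the floor DIVERGES as `a ↓ −1`. [new here — MODEL] -/
theorem origin_stretching_lower_bound (cω cl a ε K : ℝ) (U Om dOm ddOm : ℝ → ℝ) (hε : 0 ≤ ε) (ha : -1 ≤ a) (hodd : ∀ y, Om (-y) = -Om y) (hK : 0 ≤ K) (hLip : ∀ u v, |Om u - Om v| ≤ K * |u - v|)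
    (hΩi : Integrable Om) (hΩ2 : MemLp Om 2)
    (hU : ∀ ξ, HasDerivAt U (hilbertTransform Om ξ) ξ) (hOm : ∀ ξ, HasDerivAt Om (dOm ξ) ξ)
    (hdOm : ∀ ξ, HasDerivAt dOm (ddOm ξ) ξ)
    (hF : ∀ ξ ∈ Ioi (0:ℝ), F1 cω cl a 1 ε (hilbertTransform Om) U Om dOm ddOm (fun _ => 0) ξ = 0)
    (iHOm : IntegrableOn (fun ξ => hilbertTransform Om ξ * Om ξ) (Ioi 0))
    (iξd : IntegrableOn (fun ξ => ξ * dOm ξ) (Ioi 0)) (iUd : IntegrableOn (fun ξ => U ξ * dOm ξ) (Ioi 0))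
    (idd : IntegrableOn ddOm (Ioi 0))
    (hξOm : Tendsto (fun ξ => ξ * Om ξ) atTop (𝓝 0)) (hUOm : Tendsto (fun ξ => U ξ * Om ξ) atTop (𝓝 0))
    (hdOmInf : Tendsto dOm atTop (𝓝 0)) (hsign : ∀ ξ ∈ Ioi (0:ℝ), Om ξ ≤ 0) (hne : Om ≠ 0) :
    2 * (cω - cl) ≤ (1 + a) * hilbertTransform Om 0 := by
  have hOm0 : Om 0 = 0 := by
    have h := hodd 0
    rw [neg_zero] at h
    linarith
  have hfl := origin_stretching_floor cω cl a ε K U Om dOm ddOm ha hodd hK hLip hΩi hΩ2 hU hOm hdOm hF iHOm iξd iUd idd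
    hξOm hUOm hdOmInf hsign
  -- ‖Ω‖_{L¹(0,∞)} > 0 since Ω ≢ 0 (odd and continuous)
  have hd0 : 0 ≤ -dOm 0 :=
    deriv_nonneg_of_nonneg_on_Ioi (f := fun x => -Om x) ((hOm 0).neg) (by simp [hOm0])
      (fun ξ hξ => by have := hsign ξ hξ; linarith)
  have hI1 : 0 ≤ -∫ ξ in Ioi (0:ℝ), Om ξ := by
    have habs : ∫ x in Ioi (0:ℝ), |Om x| = -∫ x in Ioi (0:ℝ), Om x := by
      rw [← integral_neg]
      exact setIntegral_congr_fun measurableSet_Ioi fun x hx => abs_of_nonpos (hsign x hx)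
    rw [← habs]; exact setIntegral_nonneg measurableSet_Ioi fun x _ => abs_nonneg _
  have hI1pos : 0 < -∫ ξ in Ioi (0:ℝ), Om ξ := by
    rcases lt_or_eq_of_le hI1 with h | h
    · exact h
    · exfalso
      -- ∫₀^∞ (−Ω) = 0 with −Ω ≥ 0 continuous ⇒ Ω = 0 on (0,∞) ⇒ Ω = 0
      have hc : ContinuousOn (fun x => -Om x) (Ioi 0) := fun x _ => ((hOm x).neg).continuousAt.continuousWithinAt
      have hz := eqOn_zero_of_nonneg_of_integral_eq_zero hc (fun ξ hξ => by have := hsign ξ hξ; linarith)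
        hΩi.neg.integrableOn (by rw [integral_neg]; linarith)
      apply hne
      refine eq_zero_of_odd_of_eqOn_Ioi hodd ?_
      intro x hx
      simpa using hz hx
  have hεd : 0 ≤ ε * (-dOm 0) := mul_nonneg hε hd0
  -- divide the floor by ‖Ω‖₁
  have h2 : (cω - cl) * (-∫ ξ in Ioi (0:ℝ), Om ξ) ≤ (1 / 2) * (1 + a) * hilbertTransform Om 0 * (-∫ ξ in Ioi (0:ℝ), Om ξ) := by
    linarith
  have h3 : cω - cl ≤ (1 / 2) * (1 + a) * hilbertTransform Om 0 :=
    le_of_mul_le_mul_right h2 hI1pos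
  linarith

end SheetHalfLine
end Summit.NavierStokesRegularity.OSWSelfSimilar
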